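import Literature.NumberTheory.CubicFields.PureCubicLatticeCodes
import Mathlib.Algebra.Group.Subgroup.Lattice
import Mathlib.Algebra.Group.Subgroup.Pointwise
import Mathlib.Algebra.Group.Prod
import Mathlib.Tactic.Ring
import Mathlib.Tactic.Linarith
import Mathlib.Tactic.LinearCombination
import HarnessLib

/-!
# The three-column Hermite normal form: row spans, echelon insertion, reduction, uniqueness

Topic `NumberTheory/CubicFields`; theorem-only sequel of `PureCubicLatticeCodes.lean` (the
programs `xrow`, `ins`, `reduce`, `hnf`, `codeOf`). Pure `ℤ³` algebra (Cohen GTM 138 §2.4.2):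

* `mem_rowSpan_iff` — the row span `rowSpan s = closure {r₁, r₂, r₃}` as explicit combinations;
* `sup_xrow` — an extended-gcd elimination is unimodular: the pair spans are equal;
* `isEch_ins`, `rowSpan_ins` — insertion keeps the echelon shape and adds the new row to the span;
  `rowSpan_foldl_ins` — after inserting a list, the span is the span of the list;
* `rowSpan_reduce`, `isHNF_reduce` — the final reduction keeps the span and reaches Hermite normal
  form when the diagonal is non-zero; `diag_ne_zero_of_full` — which holds as soon as the span
  contains `N e₁, N e₂, N e₃` for some `N ≠ 0`; whence `isHNF_hnf`, `rowSpan_hnf`;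
* `eq_of_isHNF_of_rowSpan_eq` — **uniqueness of the Hermite normal form** of a full-rank lattice.

## References

* H. Cohen, *A Course in Computational Algebraic Number Theory*, GTM 138, Springer 1993, §2.4.2
  (Thm. 2.4.3: existence and uniqueness of the HNF), Algorithm 2.4.5. [Cohen1993]
-/

namespace Literature.NumberTheory.CubicFields

namespace PureCubicCodes

/-! ### Rows and row spans -/

/-- Integer multiples of a row, componentwise. [folklore] -/
theorem zsmul_row (n : ℤ) (p : Row) : n • p = (n * p.1, n * p.2.1, n * p.2.2) := by
  ext <;> simp

/-- The row span as a triple supremum of cyclic subgroups. [folklore] -/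
theorem rowSpan_eq_sup (s : Rows) : rowSpan s =
    AddSubgroup.closure {s.1} ⊔ AddSubgroup.closure {s.2.1} ⊔ AddSubgroup.closure {s.2.2} := by
  rw [rowSpan, Set.insert_eq, Set.insert_eq, AddSubgroup.closure_union, AddSubgroup.closure_union, sup_assoc]

/-- Membership in `ℤ p + ℤ v`: the integer combinations `lin2 m n p v`. [folklore] -/
theorem mem_sup_closure_pair {p v r : Row} :
    r ∈ AddSubgroup.closure {p} ⊔ AddSubgroup.closure {v} ↔ ∃ m n : ℤ, r = lin2 m n p v := by
  rw [← AddSubgroup.closure_union, Set.singleton_union, AddSubgroup.mem_closure_pair]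
  constructor
  · rintro ⟨m, n, h⟩
    exact ⟨m, n, by rw [← h, zsmul_row, zsmul_row]; rfl⟩
  · rintro ⟨m, n, h⟩
    exact ⟨m, n, by rw [h, zsmul_row, zsmul_row]; rfl⟩

/-- **Membership in the row span**: `r = u r₁ + v r₂ + w r₃`. [folklore] -/
theorem mem_rowSpan_iff {s : Rows} {r : Row} : r ∈ rowSpan s ↔ ∃ u v w : ℤ,
    r = (u * s.1.1 + v * s.2.1.1 + w * s.2.2.1, u * s.1.2.1 + v * s.2.1.2.1 + w * s.2.2.2.1,
      u * s.1.2.2 + v * s.2.1.2.2 + w * s.2.2.2.2) := by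
  rw [rowSpan_eq_sup, AddSubgroup.mem_sup]
  constructor
  · rintro ⟨y, hy, z, hz, rfl⟩
    obtain ⟨u, v, rfl⟩ := mem_sup_closure_pair.1 hy
    obtain ⟨w, rfl⟩ := AddSubgroup.mem_closure_singleton.1 hz
    refine ⟨u, v, w, ?_⟩
    rw [zsmul_row]
    refine Prod.ext ?_ (Prod.ext ?_ ?_) <;> simp [lin2]
  · rintro ⟨u, v, w, rfl⟩
    refine ⟨lin2 u v s.1 s.2.1, mem_sup_closure_pair.2 ⟨u, v, rfl⟩, w • s.2.2,
      AddSubgroup.mem_closure_singleton.2 ⟨w, rfl⟩, ?_⟩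
    rw [zsmul_row]
    refine Prod.ext ?_ (Prod.ext ?_ ?_) <;> simp [lin2]

/-- The three rows lie in their span. [folklore] -/
theorem mem_rowSpan_self (s : Rows) : s.1 ∈ rowSpan s ∧ s.2.1 ∈ rowSpan s ∧ s.2.2 ∈ rowSpan s :=
  ⟨AddSubgroup.subset_closure (by simp), AddSubgroup.subset_closure (by simp),
    AddSubgroup.subset_closure (by simp)⟩

/-- **Unimodular pairs span the same subgroup**: if `(p', v')` and `(p, v)` are integer combinations
of each other then `ℤ p' + ℤ v' = ℤ p + ℤ v`. [folklore] -/
theorem sup_closure_eq_of_lin2 {p v p' v' : Row} (α β γ δ α' β' γ' δ' : ℤ)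
    (h1 : p' = lin2 α β p v) (h2 : v' = lin2 γ δ p v) (h3 : p = lin2 α' β' p' v')
    (h4 : v = lin2 γ' δ' p' v') :
    AddSubgroup.closure {p'} ⊔ AddSubgroup.closure {v'} = AddSubgroup.closure {p} ⊔ AddSubgroup.closure {v} := by
  apply le_antisymm
  · exact sup_le
      ((AddSubgroup.closure_le _).2 (Set.singleton_subset_iff.2 (mem_sup_closure_pair.2 ⟨α, β, h1⟩)))
      ((AddSubgroup.closure_le _).2 (Set.singleton_subset_iff.2 (mem_sup_closure_pair.2 ⟨γ, δ, h2⟩)))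
  · exact sup_le
      ((AddSubgroup.closure_le _).2 (Set.singleton_subset_iff.2 (mem_sup_closure_pair.2 ⟨α', β', h3⟩)))
      ((AddSubgroup.closure_le _).2 (Set.singleton_subset_iff.2 (mem_sup_closure_pair.2 ⟨γ', δ', h4⟩)))

/-! ### The extended-gcd elimination `xrow` -/

/-- The Bezout coefficients of `(pk, vk)`, `vk ≠ 0`, satisfy `s (pk/g) + t (vk/g) = 1`. [folklore] -/
theorem gcdA_mul_ediv_add (pk vk : ℤ) (hv : vk ≠ 0) :
    Int.gcdA pk vk * (pk / Int.gcd pk vk) + Int.gcdB pk vk * (vk / Int.gcd pk vk) = 1 := by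
  have hg : ((Int.gcd pk vk : ℕ) : ℤ) ≠ 0 := by
    simp only [ne_eq, Nat.cast_eq_zero, Int.gcd_eq_zero_iff, not_and]
    exact fun _ => hv
  have h1 : pk / Int.gcd pk vk * Int.gcd pk vk = pk := Int.ediv_mul_cancel (Int.gcd_dvd_left pk vk)
  have h2 : vk / Int.gcd pk vk * Int.gcd pk vk = vk := Int.ediv_mul_cancel (Int.gcd_dvd_right pk vk)
  have h := Int.gcd_eq_gcd_ab pk vk
  refine mul_right_cancel₀ hg ?_
  calc (Int.gcdA pk vk * (pk / Int.gcd pk vk) + Int.gcdB pk vk * (vk / Int.gcd pk vk)) * Int.gcd pk vk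
      = Int.gcdA pk vk * (pk / Int.gcd pk vk * Int.gcd pk vk) +
          Int.gcdB pk vk * (vk / Int.gcd pk vk * Int.gcd pk vk) := by ring
    _ = Int.gcdA pk vk * pk + Int.gcdB pk vk * vk := by rw [h1, h2]
    _ = 1 * Int.gcd pk vk := by rw [one_mul, h]; ring

/-- **`xrow` is unimodular**: the new pair spans the same subgroup as `(p, v)`. [cite: Cohen1993, Algorithm 2.4.5] -/
theorem sup_xrow (pk vk : ℤ) (p v : Row) :
    AddSubgroup.closure {(xrow pk vk p v).1} ⊔ AddSubgroup.closure {(xrow pk vk p v).2} =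
      AddSubgroup.closure {p} ⊔ AddSubgroup.closure {v} := by
  unfold xrow
  split_ifs with hv
  · rfl
  · have key := gcdA_mul_ediv_add pk vk hv
    refine sup_closure_eq_of_lin2 (Int.gcdA pk vk) (Int.gcdB pk vk) (-(vk / Int.gcd pk vk))
      (pk / Int.gcd pk vk) (pk / Int.gcd pk vk) (-Int.gcdB pk vk) (vk / Int.gcd pk vk) (Int.gcdA pk vk)
      rfl rfl ?_ ?_
    · refine Prod.ext ?_ (Prod.ext ?_ ?_) <;> simp only [lin2]
      · linear_combination (-p.1) * key
      · linear_combination (-p.2.1) * key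
      · linear_combination (-p.2.2) * key
    · refine Prod.ext ?_ (Prod.ext ?_ ?_) <;> simp only [lin2]
      · linear_combination (-v.1) * key
      · linear_combination (-v.2.1) * key
      · linear_combination (-v.2.2) * key

/-- The eliminated coordinate of the second output row vanishes: for a coordinate functional `π`
(linear on `lin2`) reading `pk` on `p` and `vk` on `v`, `π (xrow pk vk p v).2 = 0`. [folklore] -/
theorem proj_xrow_snd_eq_zero (π : Row → ℤ) (hπ : ∀ s t p v, π (lin2 s t p v) = s * π p + t * π v)
    {pk vk : ℤ} {p v : Row} (hp : π p = pk) (hv : π v = vk) : π (xrow pk vk p v).2 = 0 := by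
  unfold xrow
  split_ifs with h
  · simpa [h] using hv
  · rw [hπ, hp, hv]
    have h1 : pk / Int.gcd pk vk * Int.gcd pk vk = pk := Int.ediv_mul_cancel (Int.gcd_dvd_left pk vk)
    have h2 : vk / Int.gcd pk vk * Int.gcd pk vk = vk := Int.ediv_mul_cancel (Int.gcd_dvd_right pk vk)
    calc -(vk / Int.gcd pk vk) * pk + pk / Int.gcd pk vk * vk
        = -(vk / Int.gcd pk vk) * (pk / Int.gcd pk vk * Int.gcd pk vk) +
            pk / Int.gcd pk vk * (vk / Int.gcd pk vk * Int.gcd pk vk) := by rw [h1, h2]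
      _ = 0 := by ring

/-- A coordinate vanishing on both rows vanishes on both output rows. [folklore] -/
theorem proj_xrow_eq_zero (π : Row → ℤ) (hπ : ∀ s t p v, π (lin2 s t p v) = s * π p + t * π v)
    (pk vk : ℤ) {p v : Row} (hp : π p = 0) (hv : π v = 0) :
    π (xrow pk vk p v).1 = 0 ∧ π (xrow pk vk p v).2 = 0 := by
  unfold xrow
  split_ifs
  · exact ⟨hp, hv⟩
  · simp [hπ, hp, hv]

/-- The first-coordinate functional is linear on `lin2`. [folklore] -/
theorem fst_lin2 (s t : ℤ) (p v : Row) : (lin2 s t p v).1 = s * p.1 + t * v.1 := rfl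

/-- The second-coordinate functional is linear on `lin2`. [folklore] -/
theorem snd_fst_lin2 (s t : ℤ) (p v : Row) : (lin2 s t p v).2.1 = s * p.2.1 + t * v.2.1 := rfl

/-- The third-coordinate functional is linear on `lin2`. [folklore] -/
theorem snd_snd_lin2 (s t : ℤ) (p v : Row) : (lin2 s t p v).2.2 = s * p.2.2 + t * v.2.2 := rfl

/-! ### Insertion -/

/-- Unfolding of `ins`. [folklore] -/
theorem ins_eq (s : Rows) (v : Row) : ins s v =
    ((xrow s.1.1 v.1 s.1 v).1,
      (xrow s.2.1.2.1 (xrow s.1.1 v.1 s.1 v).2.2.1 s.2.1 (xrow s.1.1 v.1 s.1 v).2).1,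
      (xrow s.2.2.2.2 (xrow s.2.1.2.1 (xrow s.1.1 v.1 s.1 v).2.2.1 s.2.1 (xrow s.1.1 v.1 s.1 v).2).2.2.2
        s.2.2 (xrow s.2.1.2.1 (xrow s.1.1 v.1 s.1 v).2.2.1 s.2.1 (xrow s.1.1 v.1 s.1 v).2).2).1) := rfl

/-- After the three eliminations the inserted row has become `0`, and the new triple is echelon.
[cite: Cohen1993, Algorithm 2.4.5] -/
theorem ins_aux {s : Rows} (hs : IsEch s) (v : Row) :
    IsEch (ins s v) ∧
    (xrow s.2.2.2.2 (xrow s.2.1.2.1 (xrow s.1.1 v.1 s.1 v).2.2.1 s.2.1 (xrow s.1.1 v.1 s.1 v).2).2.2.2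
        s.2.2 (xrow s.2.1.2.1 (xrow s.1.1 v.1 s.1 v).2.2.1 s.2.1 (xrow s.1.1 v.1 s.1 v).2).2).2 = 0 := by
  obtain ⟨h21, h31, h32⟩ := hs
  -- step 1: first coordinate of `v` eliminated
  have a1 : (xrow s.1.1 v.1 s.1 v).2.1 = 0 := proj_xrow_snd_eq_zero Prod.fst fst_lin2 rfl rfl
  -- step 2
  have b1 := proj_xrow_eq_zero Prod.fst fst_lin2 s.2.1.2.1 (xrow s.1.1 v.1 s.1 v).2.2.1
    (p := s.2.1) (v := (xrow s.1.1 v.1 s.1 v).2) h21 a1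
  have b2 : (xrow s.2.1.2.1 (xrow s.1.1 v.1 s.1 v).2.2.1 s.2.1 (xrow s.1.1 v.1 s.1 v).2).2.2.1 = 0 :=
    proj_xrow_snd_eq_zero (fun r => r.2.1) snd_fst_lin2 rfl rfl
  -- step 3
  have c1 := proj_xrow_eq_zero Prod.fst fst_lin2 s.2.2.2.2
    (xrow s.2.1.2.1 (xrow s.1.1 v.1 s.1 v).2.2.1 s.2.1 (xrow s.1.1 v.1 s.1 v).2).2.2.2
    (p := s.2.2) (v := (xrow s.2.1.2.1 (xrow s.1.1 v.1 s.1 v).2.2.1 s.2.1 (xrow s.1.1 v.1 s.1 v).2).2) h31 b1.2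
  have c2 := proj_xrow_eq_zero (fun r => r.2.1) snd_fst_lin2 s.2.2.2.2
    (xrow s.2.1.2.1 (xrow s.1.1 v.1 s.1 v).2.2.1 s.2.1 (xrow s.1.1 v.1 s.1 v).2).2.2.2
    (p := s.2.2) (v := (xrow s.2.1.2.1 (xrow s.1.1 v.1 s.1 v).2.2.1 s.2.1 (xrow s.1.1 v.1 s.1 v).2).2) h32 b2
  have c3 : (xrow s.2.2.2.2 (xrow s.2.1.2.1 (xrow s.1.1 v.1 s.1 v).2.2.1 s.2.1 (xrow s.1.1 v.1 s.1 v).2).2.2.2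
      s.2.2 (xrow s.2.1.2.1 (xrow s.1.1 v.1 s.1 v).2.2.1 s.2.1 (xrow s.1.1 v.1 s.1 v).2).2).2.2.2 = 0 :=
    proj_xrow_snd_eq_zero (fun r => r.2.2) snd_snd_lin2 rfl rfl
  refine ⟨⟨b1.1, c1.1, c2.1⟩, Prod.ext c1.2 (Prod.ext c2.2 c3)⟩

/-- **Insertion keeps the echelon shape.** [cite: Cohen1993, Algorithm 2.4.5] -/
theorem isEch_ins {s : Rows} (hs : IsEch s) (v : Row) : IsEch (ins s v) := (ins_aux hs v).1

/-- Three successive pair replacements inside a triple supremum. [folklore] -/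
theorem sup3_step {A B C V A' B' C' V₁ V₂ V₃ : AddSubgroup Row}
    (h1 : A' ⊔ V₁ = A ⊔ V) (h2 : B' ⊔ V₂ = B ⊔ V₁) (h3 : C' ⊔ V₃ = C ⊔ V₂) (h4 : V₃ = ⊥) :
    A' ⊔ B' ⊔ C' = A ⊔ B ⊔ C ⊔ V := by
  calc A' ⊔ B' ⊔ C' = A' ⊔ B' ⊔ (C' ⊔ V₃) := by rw [h4, sup_bot_eq]
    _ = A' ⊔ B' ⊔ (C ⊔ V₂) := by rw [h3]
    _ = A' ⊔ (B' ⊔ V₂) ⊔ C := by ac_rfl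
    _ = A' ⊔ (B ⊔ V₁) ⊔ C := by rw [h2]
    _ = (A' ⊔ V₁) ⊔ B ⊔ C := by ac_rfl
    _ = (A ⊔ V) ⊔ B ⊔ C := by rw [h1]
    _ = A ⊔ B ⊔ C ⊔ V := by ac_rfl

/-- **Insertion adds the new row to the span**: `rowSpan (ins s v) = rowSpan s + ℤ v`. [cite: Cohen1993, Algorithm 2.4.5] -/
theorem rowSpan_ins {s : Rows} (hs : IsEch s) (v : Row) :
    rowSpan (ins s v) = rowSpan s ⊔ AddSubgroup.closure {v} := by
  have h0 := (ins_aux hs v).2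
  rw [rowSpan_eq_sup, rowSpan_eq_sup, ins_eq]
  exact sup3_step (sup_xrow s.1.1 v.1 s.1 v)
    (sup_xrow s.2.1.2.1 (xrow s.1.1 v.1 s.1 v).2.2.1 s.2.1 (xrow s.1.1 v.1 s.1 v).2)
    (sup_xrow s.2.2.2.2 (xrow s.2.1.2.1 (xrow s.1.1 v.1 s.1 v).2.2.1 s.2.1 (xrow s.1.1 v.1 s.1 v).2).2.2.2
      s.2.2 (xrow s.2.1.2.1 (xrow s.1.1 v.1 s.1 v).2.2.1 s.2.1 (xrow s.1.1 v.1 s.1 v).2).2)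
    (by rw [h0, AddSubgroup.closure_singleton_zero])

/-- **Inserting a list of rows**: echelon shape is kept and the span becomes
`rowSpan s + (ℤ-span of the list)`. [cite: Cohen1993, Algorithm 2.4.5] -/
theorem rowSpan_foldl_ins : ∀ (l : List Row) {s : Rows}, IsEch s →
    IsEch (l.foldl ins s) ∧ rowSpan (l.foldl ins s) = rowSpan s ⊔ AddSubgroup.closure {x | x ∈ l}
  | [], s, hs => by simp [hs]
  | v :: l, s, hs => by
    obtain ⟨h1, h2⟩ := rowSpan_foldl_ins l (isEch_ins hs v)
    refine ⟨h1, ?_⟩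
    rw [List.foldl_cons, h2, rowSpan_ins hs v, sup_assoc, ← AddSubgroup.closure_union]
    congr 2
    ext x
    simp

/-- The zero triple is echelon with trivial span. [folklore] -/
theorem rowSpan_zero : IsEch ((0, 0, 0), (0, 0, 0), (0, 0, 0)) ∧
    rowSpan ((0, 0, 0), (0, 0, 0), (0, 0, 0)) = ⊥ := by
  refine ⟨⟨rfl, rfl, rfl⟩, ?_⟩
  rw [rowSpan, AddSubgroup.closure_eq_bot_iff]
  intro x hx
  simp only [Set.mem_insert_iff, Set.mem_singleton_iff, or_self] at hx
  rw [hx]; rfl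

/-! ### Reduction to Hermite normal form -/

/-- Sign fixing returns the row or its negative. [folklore] -/
theorem negIf_eq_or (c : ℤ) (p : Row) : negIf c p = p ∨ negIf c p = -p := by
  unfold negIf
  split_ifs
  · exact Or.inr rfl
  · exact Or.inl rfl

/-- First coordinate after sign fixing. [folklore] -/
theorem negIf_fst (c : ℤ) (p : Row) : (negIf c p).1 = if c < 0 then -p.1 else p.1 := by
  unfold negIf; split_ifs <;> rfl

/-- Second coordinate after sign fixing. [folklore] -/
theorem negIf_snd_fst (c : ℤ) (p : Row) : (negIf c p).2.1 = if c < 0 then -p.2.1 else p.2.1 := by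
  unfold negIf; split_ifs <;> rfl

/-- Third coordinate after sign fixing. [folklore] -/
theorem negIf_snd_snd (c : ℤ) (p : Row) : (negIf c p).2.2 = if c < 0 then -p.2.2 else p.2.2 := by
  unfold negIf; split_ifs <;> rfl

/-- Sign fixing does not change the generated subgroup. [folklore] -/
theorem closure_negIf (c : ℤ) (p : Row) : AddSubgroup.closure {negIf c p} = AddSubgroup.closure {p} := by
  rcases negIf_eq_or c p with h | h
  · rw [h]
  · rw [h, AddSubgroup.closure_singleton_neg]

/-- Subtracting a multiple of the second row from the first does not change `ℤ p + ℤ v`. [folklore] -/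
theorem sup_closure_lin2_one (q : ℤ) (p v : Row) :
    AddSubgroup.closure {lin2 1 (-q) p v} ⊔ AddSubgroup.closure {v} =
      AddSubgroup.closure {p} ⊔ AddSubgroup.closure {v} :=
  sup_closure_eq_of_lin2 1 (-q) 0 1 1 q 0 1 rfl
    (by refine Prod.ext ?_ (Prod.ext ?_ ?_) <;> simp only [lin2] <;> ring)
    (by refine Prod.ext ?_ (Prod.ext ?_ ?_) <;> simp only [lin2] <;> ring)
    (by refine Prod.ext ?_ (Prod.ext ?_ ?_) <;> simp only [lin2] <;> ring)

/-- Three span-preserving replacements inside a triple supremum (sign fixes, then reductions of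
`r₁` by `r₂`, of `r₁` by `r₃`, of `r₂` by `r₃`). [folklore] -/
theorem sup3_reduce {A B C A₁ B₁ C₁ A₂ A₃ B₂ : AddSubgroup Row} (ha : A₁ = A) (hb : B₁ = B) (hc : C₁ = C)
    (h1 : A₂ ⊔ B₁ = A₁ ⊔ B₁) (h2 : A₃ ⊔ C₁ = A₂ ⊔ C₁) (h3 : B₂ ⊔ C₁ = B₁ ⊔ C₁) :
    A₃ ⊔ B₂ ⊔ C₁ = A ⊔ B ⊔ C := by
  calc A₃ ⊔ B₂ ⊔ C₁ = (A₃ ⊔ C₁) ⊔ (B₂ ⊔ C₁) := by rw [sup_sup_sup_comm, sup_idem]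
    _ = (A₂ ⊔ C₁) ⊔ (B₁ ⊔ C₁) := by rw [h2, h3]
    _ = A₂ ⊔ B₁ ⊔ C₁ := by rw [sup_sup_sup_comm, sup_idem]
    _ = A₁ ⊔ B₁ ⊔ C₁ := by rw [h1]
    _ = A ⊔ B ⊔ C := by rw [ha, hb, hc]

/-- **The final reduction keeps the span.** [cite: Cohen1993, Algorithm 2.4.5] -/
theorem rowSpan_reduce (s : Rows) : rowSpan (reduce s) = rowSpan s := by
  rw [rowSpan_eq_sup, rowSpan_eq_sup]
  exact sup3_reduce (closure_negIf s.1.1 s.1) (closure_negIf s.2.1.2.1 s.2.1) (closure_negIf s.2.2.2.2 s.2.2)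
    (sup_closure_lin2_one _ _ _) (sup_closure_lin2_one _ _ _) (sup_closure_lin2_one _ _ _)

/-- Reduction of `x` by the multiple `(x / d) d` lands in `[0, d)`. [folklore] -/
theorem emod_combo (x d : ℤ) (hd : 0 < d) : 0 ≤ x + -(x / d) * d ∧ x + -(x / d) * d < d := by
  have h : x + -(x / d) * d = x % d := by rw [Int.emod_def]; ring
  rw [h]
  exact ⟨Int.emod_nonneg x hd.ne', Int.emod_lt_of_pos x hd⟩

/-- **Reduction reaches Hermite normal form** on an echelon triple with non-zero diagonal.
[cite: Cohen1993, Algorithm 2.4.5] -/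
theorem isHNF_reduce {s : Rows} (hs : IsEch s) (h1 : s.1.1 ≠ 0) (h2 : s.2.1.2.1 ≠ 0) (h3 : s.2.2.2.2 ≠ 0) :
    IsHNF (reduce s) := by
  obtain ⟨h21, h31, h32⟩ := hs
  have e11 : 0 < (negIf s.1.1 s.1).1 := by rw [negIf_fst]; split_ifs <;> omega
  have e21 : (negIf s.2.1.2.1 s.2.1).1 = 0 := by rw [negIf_fst]; split_ifs <;> omega
  have e22 : 0 < (negIf s.2.1.2.1 s.2.1).2.1 := by rw [negIf_snd_fst]; split_ifs <;> omega
  have e31 : (negIf s.2.2.2.2 s.2.2).1 = 0 := by rw [negIf_fst]; split_ifs <;> omega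
  have e32 : (negIf s.2.2.2.2 s.2.2).2.1 = 0 := by rw [negIf_snd_fst]; split_ifs <;> omega
  have e33 : 0 < (negIf s.2.2.2.2 s.2.2).2.2 := by rw [negIf_snd_snd]; split_ifs <;> omega
  have m12 := emod_combo (negIf s.1.1 s.1).2.1 _ e22
  have m23 := emod_combo (negIf s.2.1.2.1 s.2.1).2.2 _ e33
  have m13 := emod_combo ((negIf s.1.1 s.1).2.2 +
    -((negIf s.1.1 s.1).2.1 / (negIf s.2.1.2.1 s.2.1).2.1) * (negIf s.2.1.2.1 s.2.1).2.2) _ e33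
  unfold IsHNF IsEch reduce
  simp only [lin2, one_mul, e21, e31, e32, mul_zero, add_zero]
  exact ⟨⟨trivial, trivial, trivial⟩, e11, e22, e33, m12.1, m12.2, m13.1, m13.2, m23.1, m23.2⟩

/-- **Full rank forces a non-zero diagonal**: if the span of an echelon triple contains
`N e₁, N e₂, N e₃` with `N ≠ 0`, its diagonal entries are non-zero. [folklore] -/
theorem diag_ne_zero_of_full {s : Rows} (hs : IsEch s) {N : ℤ} (hN : N ≠ 0)
    (h1 : ((N, 0, 0) : Row) ∈ rowSpan s) (h2 : ((0, N, 0) : Row) ∈ rowSpan s)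
    (h3 : ((0, 0, N) : Row) ∈ rowSpan s) : s.1.1 ≠ 0 ∧ s.2.1.2.1 ≠ 0 ∧ s.2.2.2.2 ≠ 0 := by
  obtain ⟨h21, h31, h32⟩ := hs
  obtain ⟨u₁, v₁, w₁, e₁⟩ := mem_rowSpan_iff.1 h1
  obtain ⟨u₂, v₂, w₂, e₂⟩ := mem_rowSpan_iff.1 h2
  obtain ⟨u₃, v₃, w₃, e₃⟩ := mem_rowSpan_iff.1 h3
  simp only [Prod.mk.injEq, h21, h31, h32, mul_zero, add_zero] at e₁ e₂ e₃
  have d1 : s.1.1 ≠ 0 := fun h => hN (by rw [e₁.1, h, mul_zero])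
  have d2 : s.2.1.2.1 ≠ 0 := by
    intro h
    obtain ⟨ea, eb, -⟩ := e₂
    have hu : u₂ = 0 := (mul_eq_zero.1 ea.symm).resolve_right d1
    apply hN
    rw [eb, hu, h]; ring
  have d3 : s.2.2.2.2 ≠ 0 := by
    intro h
    obtain ⟨ea, eb, ec⟩ := e₃
    have hu : u₃ = 0 := (mul_eq_zero.1 ea.symm).resolve_right d1
    rw [hu, zero_mul, zero_add] at eb
    have hv : v₃ = 0 := (mul_eq_zero.1 eb.symm).resolve_right d2
    apply hN
    rw [ec, hu, hv, h]; ring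
  exact ⟨d1, d2, d3⟩

/-! ### The Hermite normal form of a list of generators -/

/-- **The HNF spans the lattice of the generators.** [cite: Cohen1993, §2.4.2, Algorithm 2.4.5] -/
theorem rowSpan_hnf (gens : List Row) : rowSpan (hnf gens) = AddSubgroup.closure {x | x ∈ gens} := by
  rw [hnf, rowSpan_reduce, (rowSpan_foldl_ins gens rowSpan_zero.1).2, rowSpan_zero.2, bot_sup_eq]

/-- The HNF is an echelon triple. [folklore] -/
theorem isEch_hnf (gens : List Row) : IsEch (hnf gens) := by
  have hE := (rowSpan_foldl_ins gens rowSpan_zero.1).1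
  unfold hnf reduce IsEch
  have a := hE.1
  have b := hE.2.1
  have c := hE.2.2
  refine ⟨?_, ?_, ?_⟩
  · simp only [lin2]
    rw [negIf_fst, negIf_fst, a, b]
    simp
  · rw [negIf_fst]; split_ifs <;> omega
  · rw [negIf_snd_fst]; split_ifs <;> omega

/-- **The HNF of a full-rank list is in Hermite normal form**: full rank is witnessed by
`N e₁, N e₂, N e₃` in the span for some `N ≠ 0`. [cite: Cohen1993, §2.4.2 (Thm. 2.4.3), Algorithm 2.4.5] -/
theorem isHNF_hnf (gens : List Row) {N : ℤ} (hN : N ≠ 0)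
    (h1 : ((N, 0, 0) : Row) ∈ AddSubgroup.closure {x | x ∈ gens})
    (h2 : ((0, N, 0) : Row) ∈ AddSubgroup.closure {x | x ∈ gens})
    (h3 : ((0, 0, N) : Row) ∈ AddSubgroup.closure {x | x ∈ gens}) : IsHNF (hnf gens) := by
  have hE := rowSpan_foldl_ins gens rowSpan_zero.1
  rw [rowSpan_zero.2, bot_sup_eq] at hE
  rw [← hE.2] at h1 h2 h3
  obtain ⟨d1, d2, d3⟩ := diag_ne_zero_of_full hE.1 hN h1 h2 h3
  exact isHNF_reduce hE.1 d1 d2 d3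

end PureCubicCodes

end Literature.NumberTheory.CubicFields
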